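import Summits.AtomisticToContinuum.BoseEinsteinCondensation.Theorems.BECDyadicChainingCoherentAmplitudeMonotone
import HarnessLib

/-!
# Route `BECDyadicChaining` — crux `DyadicCoherenceDefect`, stub `stub_levelIncrement`

The pure Hilbert-space-geometry input of the crux line: for a Dirichlet trial state
`Ψ ∈ TrialState N L` and a dyadic level `m ≥ 1`, with the flat modes `φ_{m,i}` of the `8^m` open
cubes of side `L/2^m`, the total level occupations `T_m = ∑_i ⟨φ_{m,i}, γ_Ψ φ_{m,i}⟩` and the coherent
amplitudes `A_m = 8^{-m/2} ∑_i √⟨φ_{m,i}, γ_Ψ φ_{m,i}⟩` satisfy the ladder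
`T_{m-1} ≤ T_m ≤ N` and the increment bound `A_m ≤ A_{m-1} + √(T_m - T_{m-1})`.

Proof. `T_{m-1} ≤ T_m` and `T_m ≤ N` are `cohSum_le_cohSum_succ_trialState` and `cohSum_le_card`
(refinement monotonicity and the Bessel bound of the dyadic coherent sum). For the increment, write
`n_P` for the occupation of a parent cube `P` of level `k = m - 1` and `M_P = ∑_c n_{C_c}` for the total
occupation of its eight children. Cauchy–Schwarz over the eight children and `n_P ≤ M_P`
(`occupation_dyMode_le_sum_dyChild`) give
`∑_c √n_{C_c} ≤ √8 √M_P = √8 √(n_P + (M_P - n_P)) ≤ √8 √n_P + √8 √(M_P - n_P)`,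
and Cauchy–Schwarz over the `8^k` parents gives `∑_P √(M_P - n_P) ≤ 8^{k/2} √(T_{k+1} - T_k)`
(`∑_P M_P = T_{k+1}` because `(P, c) ↦ dyChild P c` is a bijection onto the level-`k+1` indices).
Multiplying by `8^{-(k+1)/2}` yields `A_{k+1} ≤ A_k + √(T_{k+1} - T_k)`. Everything is in `ℝ≥0∞`
(truncated subtraction, `rpow (1/2)`); the only finiteness used is `T_k ≤ N < ⊤`. The route's open
cubes are a.e. the half-open cells `dyCell` (`openCell_ae_eq_dyCell`, `occupation_congr_ae`).

No new definitions.
-/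

noncomputable section

namespace Summit.AtomisticToContinuum.BoseEinsteinCondensation.Cruxes.DyadicCoherenceDefect.Birth

open Filter MeasureTheory
open scoped ENNReal NNReal BigOperators
open Literature.MathematicalPhysics.QuantumManyBody.BoseGas
open Summit.AtomisticToContinuum.BoseEinsteinCondensation.Theses
open Summit.AtomisticToContinuum.BoseEinsteinCondensation.Theorems

namespace LevelIncrement

/-- **Reindexing a level by parents and children.** `(P, c) ↦ dyChild P c` is a bijection from
(level-`k` index) × `{0,1}³` onto the level-`k+1` indices (injective, and `8^k · 8 = 8^{k+1}`), so a
sum over level `k+1` is the sum over parents of the sums over their eight children. [folklore] -/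
theorem sum_dyLevel_succ {M : Type*} [AddCommMonoid M] (k : ℕ)
    (f : (Fin 3 → Fin (2 ^ (k + 1))) → M) :
    ∑ i, f i = ∑ m : Fin 3 → Fin (2 ^ k), ∑ c : Fin 3 → Fin 2, f (dyChild m c) := by
  have hbij : Function.Bijective
      fun p : (Fin 3 → Fin (2 ^ k)) × (Fin 3 → Fin 2) => dyChild p.1 p.2 := by
    rw [Fintype.bijective_iff_injective_and_card]
    refine ⟨dyChild_injective2, ?_⟩
    rw [Fintype.card_prod, card_dyIndex, card_dyIndex, Fintype.card_fun, Fintype.card_fin,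
      Fintype.card_fin]
    ring
  calc ∑ i, f i = ∑ p : (Fin 3 → Fin (2 ^ k)) × (Fin 3 → Fin 2), f (dyChild p.1 p.2) :=
        (hbij.sum_comp f).symm
    _ = ∑ m : Fin 3 → Fin (2 ^ k), ∑ c : Fin 3 → Fin 2, f (dyChild m c) :=
        Fintype.sum_prod_type' fun m c => f (dyChild m c)

/-- **Cauchy–Schwarz in `ℝ≥0∞`**: `∑_i a_i^{1/2} ≤ (card ι)^{1/2} (∑_i a_i)^{1/2}` (Hölder with
exponents `2, 2` against the constant function `1`). [folklore] -/
theorem sum_rpow_half_le {ι : Type*} [Fintype ι] (a : ι → ℝ≥0∞) :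
    ∑ i, (a i) ^ (1 / 2 : ℝ) ≤
      (Fintype.card ι : ℝ≥0∞) ^ (1 / 2 : ℝ) * (∑ i, a i) ^ (1 / 2 : ℝ) := by
  have h := ENNReal.inner_le_Lp_mul_Lq Finset.univ (fun i => (a i) ^ (1 / 2 : ℝ)) (fun _ => 1)
    Real.HolderConjugate.two_two
  have h2 : ∀ i, ((a i) ^ (1 / 2 : ℝ)) ^ (2 : ℝ) = a i := fun i => by
    rw [← ENNReal.rpow_mul]
    norm_num
  simp only [mul_one, h2, ENNReal.one_rpow, Finset.sum_const, Finset.card_univ, nsmul_eq_mul] at h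
  calc ∑ i, (a i) ^ (1 / 2 : ℝ)
      ≤ (∑ i, a i) ^ (1 / (2 : ℝ)) * (Fintype.card ι : ℝ≥0∞) ^ (1 / (2 : ℝ)) := h
    _ = _ := mul_comm _ _

/-- **Subadditivity of the square root** along `M = n + (M - n)`:
`M^{1/2} ≤ n^{1/2} + (M - n)^{1/2}` for `n ≤ M` in `ℝ≥0∞`. [folklore] -/
theorem rpow_half_le_add_rpow_half_tsub {n M : ℝ≥0∞} (h : n ≤ M) :
    M ^ (1 / 2 : ℝ) ≤ n ^ (1 / 2 : ℝ) + (M - n) ^ (1 / 2 : ℝ) := by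
  calc M ^ (1 / 2 : ℝ) = (n + (M - n)) ^ (1 / 2 : ℝ) := by rw [add_tsub_cancel_of_le h]
    _ ≤ n ^ (1 / 2 : ℝ) + (M - n) ^ (1 / 2 : ℝ) :=
        ENNReal.rpow_add_le_add_rpow _ _ (by norm_num) (by norm_num)

/-- **Sum of truncated differences**: `∑_i (f_i - g_i) ≤ ∑_i f_i - ∑_i g_i` in `ℝ≥0∞` when
`g ≤ f` termwise and `∑ g` is finite. [folklore] -/
theorem sum_tsub_le_tsub_sum {ι : Type*} (s : Finset ι) {f g : ι → ℝ≥0∞}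
    (hle : ∀ i ∈ s, g i ≤ f i) (hg : ∑ i ∈ s, g i ≠ ⊤) :
    ∑ i ∈ s, (f i - g i) ≤ ∑ i ∈ s, f i - ∑ i ∈ s, g i := by
  refine ENNReal.le_sub_of_add_le_right hg ?_
  rw [← Finset.sum_add_distrib]
  exact Finset.sum_le_sum fun i hi => (tsub_add_cancel_of_le (hle i hi)).le

/-- **The increment bound, abstractly.** For level occupations `x` (level `k+1`) and `y` (level
`k`) in `ℝ≥0∞` with `y_P ≤ ∑_c x_{dyChild P c}` for every parent `P` and `∑_P y_P < ⊤`: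
`8^{-(k+1)/2} ∑_i x_i^{1/2} ≤ 8^{-k/2} ∑_P y_P^{1/2} + (∑_i x_i - ∑_P y_P)^{1/2}` — Cauchy–Schwarz over
the eight children of each parent, `√M ≤ √n + √(M - n)`, and Cauchy–Schwarz over the `8^k`
parents. [folklore] -/
theorem amplitude_succ_le_abstract (k : ℕ) (x : (Fin 3 → Fin (2 ^ (k + 1))) → ℝ≥0∞)
    (y : (Fin 3 → Fin (2 ^ k)) → ℝ≥0∞) (hle : ∀ P, y P ≤ ∑ c, x (dyChild P c))
    (hfin : ∑ P, y P ≠ ⊤) :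
    (8 : ℝ≥0∞) ^ (-((k + 1 : ℕ) : ℝ) / 2) * ∑ i, (x i) ^ (1 / 2 : ℝ) ≤
      (8 : ℝ≥0∞) ^ (-(k : ℝ) / 2) * ∑ P, (y P) ^ (1 / 2 : ℝ) +
        (∑ i, x i - ∑ P, y P) ^ (1 / 2 : ℝ) := by
  -- exponent bookkeeping
  have h8 : (8 : ℝ≥0∞) ^ (-((k + 1 : ℕ) : ℝ) / 2) * (8 : ℝ≥0∞) ^ (1 / 2 : ℝ) =
      (8 : ℝ≥0∞) ^ (-(k : ℝ) / 2) := by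
    rw [← ENNReal.rpow_add _ _ (by norm_num) (by simp)]
    congr 1
    push_cast
    ring
  have hcardP : (Fintype.card (Fin 3 → Fin (2 ^ k)) : ℝ≥0∞) ^ (1 / 2 : ℝ) =
      (8 : ℝ≥0∞) ^ ((k : ℝ) / 2) := by
    rw [card_dyIndex, Nat.cast_pow, Nat.cast_ofNat, ← ENNReal.rpow_natCast, ← ENNReal.rpow_mul]
    congr 1
    ring
  have h1 : (8 : ℝ≥0∞) ^ (-(k : ℝ) / 2) * (8 : ℝ≥0∞) ^ ((k : ℝ) / 2) = 1 := by
    rw [← ENNReal.rpow_add _ _ (by norm_num) (by simp), ← ENNReal.rpow_zero (x := 8)]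
    congr 1
    ring
  have hcardC : (Fintype.card (Fin 3 → Fin 2) : ℝ≥0∞) = 8 := by simp
  -- one parent against its eight children
  have hP : ∀ P, ∑ c, (x (dyChild P c)) ^ (1 / 2 : ℝ) ≤
      (8 : ℝ≥0∞) ^ (1 / 2 : ℝ) * (y P) ^ (1 / 2 : ℝ) +
        (8 : ℝ≥0∞) ^ (1 / 2 : ℝ) * (∑ c, x (dyChild P c) - y P) ^ (1 / 2 : ℝ) := fun P =>
    calc ∑ c, (x (dyChild P c)) ^ (1 / 2 : ℝ)
        ≤ (8 : ℝ≥0∞) ^ (1 / 2 : ℝ) * (∑ c, x (dyChild P c)) ^ (1 / 2 : ℝ) := by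
          simpa only [hcardC] using sum_rpow_half_le fun c => x (dyChild P c)
      _ ≤ (8 : ℝ≥0∞) ^ (1 / 2 : ℝ) *
            ((y P) ^ (1 / 2 : ℝ) + (∑ c, x (dyChild P c) - y P) ^ (1 / 2 : ℝ)) := by
          gcongr
          exact rpow_half_le_add_rpow_half_tsub (hle P)
      _ = _ := mul_add _ _ _
  -- the defects of all parents, by Cauchy–Schwarz over the `8^k` parents
  have hD : ∑ P, (∑ c, x (dyChild P c) - y P) ^ (1 / 2 : ℝ) ≤
      (8 : ℝ≥0∞) ^ ((k : ℝ) / 2) * (∑ i, x i - ∑ P, y P) ^ (1 / 2 : ℝ) :=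
    calc ∑ P, (∑ c, x (dyChild P c) - y P) ^ (1 / 2 : ℝ)
        ≤ (8 : ℝ≥0∞) ^ ((k : ℝ) / 2) * (∑ P, (∑ c, x (dyChild P c) - y P)) ^ (1 / 2 : ℝ) := by
          simpa only [hcardP] using sum_rpow_half_le fun P => ∑ c, x (dyChild P c) - y P
      _ ≤ (8 : ℝ≥0∞) ^ ((k : ℝ) / 2) * (∑ i, x i - ∑ P, y P) ^ (1 / 2 : ℝ) := by
          gcongr
          rw [sum_dyLevel_succ k x]
          exact sum_tsub_le_tsub_sum _ (fun P _ => hle P) hfin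
  -- assemble
  calc (8 : ℝ≥0∞) ^ (-((k + 1 : ℕ) : ℝ) / 2) * ∑ i, (x i) ^ (1 / 2 : ℝ)
      = (8 : ℝ≥0∞) ^ (-((k + 1 : ℕ) : ℝ) / 2) * ∑ P, ∑ c, (x (dyChild P c)) ^ (1 / 2 : ℝ) := by
        rw [sum_dyLevel_succ k fun i => (x i) ^ (1 / 2 : ℝ)]
    _ ≤ (8 : ℝ≥0∞) ^ (-((k + 1 : ℕ) : ℝ) / 2) * ∑ P, ((8 : ℝ≥0∞) ^ (1 / 2 : ℝ) * (y P) ^ (1 / 2 : ℝ) +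
          (8 : ℝ≥0∞) ^ (1 / 2 : ℝ) * (∑ c, x (dyChild P c) - y P) ^ (1 / 2 : ℝ)) := by
        gcongr with P
        exact hP P
    _ = (8 : ℝ≥0∞) ^ (-(k : ℝ) / 2) * ∑ P, (y P) ^ (1 / 2 : ℝ) +
          (8 : ℝ≥0∞) ^ (-(k : ℝ) / 2) * ∑ P, (∑ c, x (dyChild P c) - y P) ^ (1 / 2 : ℝ) := by
        rw [Finset.sum_add_distrib, ← Finset.mul_sum, ← Finset.mul_sum, mul_add, ← mul_assoc,
          ← mul_assoc, h8]
    _ ≤ (8 : ℝ≥0∞) ^ (-(k : ℝ) / 2) * ∑ P, (y P) ^ (1 / 2 : ℝ) +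
          (8 : ℝ≥0∞) ^ (-(k : ℝ) / 2) *
            ((8 : ℝ≥0∞) ^ ((k : ℝ) / 2) * (∑ i, x i - ∑ P, y P) ^ (1 / 2 : ℝ)) := by
        gcongr
    _ = _ := by rw [← mul_assoc, h1, one_mul]

/-- **The increment bound over the half-open dyadic cells.** For a Dirichlet trial state `Ψ` and
every level `k`, with `T_k = ∑_i ⟨dyMode L k i, γ_Ψ dyMode L k i⟩` and
`A_k = 8^{-k/2} ∑_i ⟨dyMode L k i, γ_Ψ dyMode L k i⟩^{1/2}`:
`A_{k+1} ≤ A_k + (T_{k+1} - T_k)^{1/2}`. [cite: LSSY2005, §1.2 (1.17)] -/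
theorem amplitude_dyMode_succ_le (L : ℝ) (k : ℕ) {N : ℕ} {L' : ℝ} (Ψ : TrialState N L') :
    (8 : ℝ≥0∞) ^ (-((k + 1 : ℕ) : ℝ) / 2) *
        ∑ i : Fin 3 → Fin (2 ^ (k + 1)), (occupation N (dyMode L (k + 1) i) Ψ.ψ) ^ (1 / 2 : ℝ) ≤
      (8 : ℝ≥0∞) ^ (-(k : ℝ) / 2) *
          ∑ i : Fin 3 → Fin (2 ^ k), (occupation N (dyMode L k i) Ψ.ψ) ^ (1 / 2 : ℝ) +
        (∑ i : Fin 3 → Fin (2 ^ (k + 1)), occupation N (dyMode L (k + 1) i) Ψ.ψ -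
          ∑ i : Fin 3 → Fin (2 ^ k), occupation N (dyMode L k i) Ψ.ψ) ^ (1 / 2 : ℝ) := by
  cases N with
  | zero => simp [occupation]
  | succ n =>
    exact amplitude_succ_le_abstract k (fun i => occupation (n + 1) (dyMode L (k + 1) i) Ψ.ψ)
      (fun P => occupation (n + 1) (dyMode L k P) Ψ.ψ)
      (fun P => occupation_dyMode_le_sum_dyChild L k P Ψ.contDiff.continuous.measurable)
      (ne_top_of_le_ne_top (ENNReal.natCast_ne_top (n + 1)) (cohSum_le_card L k Ψ))

/-- **Ladder and increment bound over the route's open cubes**, level `k` against level `k+1`: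
`T_k ≤ T_{k+1}`, `T_{k+1} ≤ N`, `A_{k+1} ≤ A_k + (T_{k+1} - T_k)^{1/2}` for the flat modes of the open
dyadic cubes of a Dirichlet trial state (the open cubes are a.e. the half-open cells, and
`occupation` only sees the mode a.e.). [cite: LSSY2005, §1.2 (1.17)] -/
theorem levelIncrement_openCube (N : ℕ) (L : ℝ) (Ψ : TrialState N L) (k : ℕ) :
    ∑ i : Fin 3 → Fin (2 ^ k), occupation N (Set.indicator
        {x : EuclideanSpace ℝ (Fin 3) | ∀ j : Fin 3, x j ∈ Set.Ioo (((i j : ℕ) : ℝ) * (L / 2 ^ k))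
          ((((i j : ℕ) : ℝ) + 1) * (L / 2 ^ k))}
        (fun _ => ((Real.sqrt ((L / 2 ^ k) ^ 3))⁻¹ : ℂ))) Ψ.ψ ≤
      ∑ i : Fin 3 → Fin (2 ^ (k + 1)), occupation N (Set.indicator
        {x : EuclideanSpace ℝ (Fin 3) | ∀ j : Fin 3, x j ∈
          Set.Ioo (((i j : ℕ) : ℝ) * (L / 2 ^ (k + 1))) ((((i j : ℕ) : ℝ) + 1) * (L / 2 ^ (k + 1)))}
        (fun _ => ((Real.sqrt ((L / 2 ^ (k + 1)) ^ 3))⁻¹ : ℂ))) Ψ.ψ ∧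
    ∑ i : Fin 3 → Fin (2 ^ (k + 1)), occupation N (Set.indicator
        {x : EuclideanSpace ℝ (Fin 3) | ∀ j : Fin 3, x j ∈
          Set.Ioo (((i j : ℕ) : ℝ) * (L / 2 ^ (k + 1))) ((((i j : ℕ) : ℝ) + 1) * (L / 2 ^ (k + 1)))}
        (fun _ => ((Real.sqrt ((L / 2 ^ (k + 1)) ^ 3))⁻¹ : ℂ))) Ψ.ψ ≤ N ∧
    (8 : ℝ≥0∞) ^ (-((k + 1 : ℕ) : ℝ) / 2) * ∑ i : Fin 3 → Fin (2 ^ (k + 1)), (occupation N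
        (Set.indicator {x : EuclideanSpace ℝ (Fin 3) | ∀ j : Fin 3, x j ∈
          Set.Ioo (((i j : ℕ) : ℝ) * (L / 2 ^ (k + 1))) ((((i j : ℕ) : ℝ) + 1) * (L / 2 ^ (k + 1)))}
        (fun _ => ((Real.sqrt ((L / 2 ^ (k + 1)) ^ 3))⁻¹ : ℂ))) Ψ.ψ) ^ (1 / 2 : ℝ) ≤
      (8 : ℝ≥0∞) ^ (-(k : ℝ) / 2) * ∑ i : Fin 3 → Fin (2 ^ k), (occupation N (Set.indicator
        {x : EuclideanSpace ℝ (Fin 3) | ∀ j : Fin 3, x j ∈ Set.Ioo (((i j : ℕ) : ℝ) * (L / 2 ^ k))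
          ((((i j : ℕ) : ℝ) + 1) * (L / 2 ^ k))}
        (fun _ => ((Real.sqrt ((L / 2 ^ k) ^ 3))⁻¹ : ℂ))) Ψ.ψ) ^ (1 / 2 : ℝ) +
      (∑ i : Fin 3 → Fin (2 ^ (k + 1)), occupation N (Set.indicator
        {x : EuclideanSpace ℝ (Fin 3) | ∀ j : Fin 3, x j ∈
          Set.Ioo (((i j : ℕ) : ℝ) * (L / 2 ^ (k + 1))) ((((i j : ℕ) : ℝ) + 1) * (L / 2 ^ (k + 1)))}
        (fun _ => ((Real.sqrt ((L / 2 ^ (k + 1)) ^ 3))⁻¹ : ℂ))) Ψ.ψ -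
       ∑ i : Fin 3 → Fin (2 ^ k), occupation N (Set.indicator
        {x : EuclideanSpace ℝ (Fin 3) | ∀ j : Fin 3, x j ∈ Set.Ioo (((i j : ℕ) : ℝ) * (L / 2 ^ k))
          ((((i j : ℕ) : ℝ) + 1) * (L / 2 ^ k))}
        (fun _ => ((Real.sqrt ((L / 2 ^ k) ^ 3))⁻¹ : ℂ))) Ψ.ψ) ^ (1 / 2 : ℝ) := by
  have h : ∀ (k : ℕ) (i : Fin 3 → Fin (2 ^ k)), occupation N (Set.indicator
        {x : EuclideanSpace ℝ (Fin 3) | ∀ j : Fin 3, x j ∈ Set.Ioo (((i j : ℕ) : ℝ) * (L / 2 ^ k))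
          ((((i j : ℕ) : ℝ) + 1) * (L / 2 ^ k))}
        (fun _ => ((Real.sqrt ((L / 2 ^ k) ^ 3))⁻¹ : ℂ))) Ψ.ψ = occupation N (dyMode L k i) Ψ.ψ :=
    fun k i => occupation_congr_ae (indicator_ae_eq_of_ae_eq_set
      (CoherentAmplitudeMonotone.openCell_ae_eq_dyCell L k i)) Ψ.ψ
  simp only [h]
  exact ⟨cohSum_le_cohSum_succ_trialState L k Ψ, cohSum_le_card L (k + 1) Ψ,
    amplitude_dyMode_succ_le L k Ψ⟩

end LevelIncrement

/-- **Stub S2: level-occupation ladder and increment bound** (`LevelIncrement`). For every `N`, `L`,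
every Dirichlet trial state `Ψ ∈ TrialState N L` and every level `m ≥ 1`, with the flat modes
`φ_{m,i}` of the `8^m` open dyadic cubes of side `L/2^m`, the level occupations
`T_m = ∑_i ⟨φ_{m,i}, γ_Ψ φ_{m,i}⟩` and coherent amplitudes `A_m = 8^{-m/2} ∑_i ⟨φ_{m,i}, γ_Ψ φ_{m,i}⟩^{1/2}`
satisfy `T_{m-1} ≤ T_m ≤ N` and `A_m ≤ A_{m-1} + (T_m - T_{m-1})^{1/2}` (Cauchy–Schwarz over the eight
children of each parent cube and over the parents; Bessel for `T_m ≤ N`).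
[cite: LSSY2005, §1.2 (1.17)] -/
theorem stub_levelIncrement :
    ∀ (N : ℕ) (L : ℝ) (Ψ : TrialState N L) (m : ℕ), 1 ≤ m →
      let φ : (m : ℕ) → (Fin 3 → Fin (2 ^ m)) → EuclideanSpace ℝ (Fin 3) → ℂ := fun m i =>
        Set.indicator {x : EuclideanSpace ℝ (Fin 3) | ∀ k : Fin 3, x k ∈
            Set.Ioo (((i k : ℕ) : ℝ) * (L / 2 ^ m)) ((((i k : ℕ) : ℝ) + 1) * (L / 2 ^ m))}
          (fun _ => ((Real.sqrt ((L / 2 ^ m) ^ 3))⁻¹ : ℂ))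
      let T : ℕ → ℝ≥0∞ := fun m => ∑ i : Fin 3 → Fin (2 ^ m), occupation N (φ m i) Ψ.ψ
      let A : ℕ → ℝ≥0∞ := fun m => (8 : ℝ≥0∞) ^ (-(m : ℝ) / 2) *
        ∑ i : Fin 3 → Fin (2 ^ m), (occupation N (φ m i) Ψ.ψ) ^ (1 / 2 : ℝ)
      T (m - 1) ≤ T m ∧ T m ≤ N ∧ A m ≤ A (m - 1) + (T m - T (m - 1)) ^ (1 / 2 : ℝ) := by
  intro N L Ψ m hm
  obtain ⟨k, rfl⟩ : ∃ k, m = k + 1 := ⟨m - 1, by omega⟩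
  exact LevelIncrement.levelIncrement_openCube N L Ψ k

end Summit.AtomisticToContinuum.BoseEinsteinCondensation.Cruxes.DyadicCoherenceDefect.Birth

end
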